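import Summits.HodgeConjecture.HodgeConjecture.Theses.AnchorTransport
import Literature.AlgebraicGeometry.HodgeTheory.AlgebraicityLocus
import Summits.HodgeConjecture.HodgeConjecture.Theorems.PadicSemiregularLiftHodgeAbelianVarietiesStubVhcFromCMFibre

/-!
# Route AnchorTransport — `VariationalHodge` (stmt-HodgeConjecture-1076): closing from a thick set of points

The algebraicity locus `{t ∈ S(ℂ) | A|_{𝒳_t} ∈ Nᵖ H²ᵖ(𝒳_t(ℂ); ℂ)}` of a global class `A` on a smooth
projective family `f : 𝒳 ⟶ S` with quasi-projective total space and base is a COUNTABLE UNION of sets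
of complex points of Zariski-closed subsets of `S` (relative Hilbert schemes are proper with countably
many components: Charles–Schnell, *Notes on absolute Hodge classes*, proof of Prop. 11.3.11; Voisin
2007, §0; the tree's named fact `charlesSchnell_algebraicityLocus_iUnion_closed`). Hence the CLOSING
LEMMA shared by the crux lines `tame-symbol-splitting` and `gw-section-transport` (crux workfile
`Cruxes/VariationalHodge/IdeatorOneSketch.lean`, `ClosingFromThickSet`), in its honest form — with the
quasi-projectivity the fact needs, which the crux as filed does not grant (its families are only smooth
and proper with projective fibres):

* `variationalHodge_closing_of_thickSet` — if the fibre restrictions of `A` are algebraic on a set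
  `Λ ⊆ S(ℂ)` that is not contained in any countable union of complex-point sets of PROPER Zariski-closed
  subsets of `S`, they are algebraic at every complex point;
* `variationalHodge_closing_iff` — equivalently, the fibre restrictions of `A` are algebraic everywhere
  iff the algebraicity locus is not contained in such a countable union.

No irreducibility of `S` is needed for these two statements (it enters only when a line proves
thickness of its `Λ`, e.g. the complex points over a dense open of an irreducible base).

* `univ_not_subset_iUnion_setOf_pt_mem`, `variationalHodge_closing_iff_of_irreducible` — for `S`
  irreducible and quasi-projective the thickness of `S(ℂ)` itself is a theorem (Baire: the tree's
  proved `exists_eq_univ_of_isOpen_subset_iUnion`), so the `iff` holds outright;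
* `variationalHodge_conclusion_of_isOpen` — the LOCAL-TO-GLOBAL form: algebraic on a non-empty
  Euclidean-open set of `S(ℂ)` ⟹ algebraic at every complex point (the tree's proved
  `map_fiberι_mem_algebraicClasses_of_isOpen`, same fact).
-/

noncomputable section

-- every declaration of this problem lives in `Summit.HodgeConjecture.HodgeConjecture.…` (summit = sub-problem)
set_option linter.dupNamespace false

open CategoryTheory AlgebraicGeometry
open Literature.AlgebraicGeometry.Motives Literature.AlgebraicGeometry.HodgeTheory
open Summit.HodgeConjecture.HodgeConjecture.Cruxes.HodgeAbelianVarieties.SubtorusGalleryBlochSeeds.Stubs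
  (exists_eq_univ_of_isOpen_subset_iUnion map_fiberι_mem_algebraicClasses_of_isOpen)

namespace Summit.HodgeConjecture.HodgeConjecture.Theorems

variable {n p : ℕ} {𝒳 S : SchemeOver ℂ} (f : 𝒳 ⟶ S)

/-- **Closing lemma (from a thick set of points).** For a smooth projective family `f : 𝒳 ⟶ S` of
relative dimension `n` with `𝒳`, `S` quasi-projective and `S` smooth over `ℂ`, and a global class
`A ∈ H²ᵖ(𝒳(ℂ); ℂ)`: if `A|_{𝒳_t}` is algebraic for every `t` in a set `Λ ⊆ S(ℂ)` which is NOT contained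
in any countable union `⋃ₖ Zₖ(ℂ)` with all `Zₖ ⊊ S` Zariski-closed and proper, then `A|_{𝒳_t}` is
algebraic for every `t ∈ S(ℂ)`. Proof: the algebraicity locus is `⋃ⱼ Wⱼ(ℂ)` for closed `Wⱼ`
(`charlesSchnell_algebraicityLocus_iUnion_closed`); if some `Wⱼ = S` we are done, otherwise `Λ` lies in
a forbidden union. [cite: CharlesSchnell2014Notes, Prop. 11.3.11 (proof)]
[cite: Voisin2007HodgeLoci, §0 (Introduction), first paragraph] -/
theorem variationalHodge_closing_of_thickSet (hCS : charlesSchnell_algebraicityLocus_iUnion_closed)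
    (h𝒳 : IsQuasiProjectiveOver 𝒳) (hS : IsQuasiProjectiveOver S) (hSsm : AlgebraicGeometry.Smooth S.hom)
    (hf : IsSmoothProjectiveFamily f n) (A : complexBetti 𝒳 (2 * p)) (Λ : Set (ComplexPoints S))
    (hΛ : ∀ Z : ℕ → Set S.left, (∀ k, IsClosed (Z k)) → (∀ k, Z k ≠ Set.univ) →
      ¬ Λ ⊆ ⋃ k, {t : ComplexPoints S | t.pt ∈ Z k})
    (halg : ∀ t ∈ Λ, complexBetti.map (fiberι f t) (2 * p) A ∈ algebraicClasses (fiberOver f t) p)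
    (t : ComplexPoints S) :
    complexBetti.map (fiberι f t) (2 * p) A ∈ algebraicClasses (fiberOver f t) p := by
  obtain ⟨W, hWc, hW⟩ := hCS f n p h𝒳 hS hSsm hf A
  by_cases huniv : ∃ j, W j = Set.univ
  · obtain ⟨j, hj⟩ := huniv
    have ht : t ∈ ⋃ j, {t : ComplexPoints S | t.pt ∈ W j} :=
      Set.mem_iUnion.2 ⟨j, by simp only [Set.mem_setOf_eq, hj, Set.mem_univ]⟩
    rw [← hW] at ht
    exact ht
  · push Not at huniv
    exact absurd (fun s hs => hW ▸ (halg s hs : s ∈ {t : ComplexPoints S |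
      complexBetti.map (fiberι f t) (2 * p) A ∈ algebraicClasses (fiberOver f t) p})) (hΛ W hWc huniv)

/-- **The algebraicity locus is everything iff it is thick**: under the same hypotheses, `A|_{𝒳_t}` is
algebraic for all `t ∈ S(ℂ)` iff the algebraicity locus of `A` is not contained in any countable union
of complex-point sets of proper Zariski-closed subsets of `S` — provided `S` has a complex point outside
every such union (hypothesis `hthick`, the Baire / uncountability property of `S(ℂ)`, which a line
supplies for its bases; without it the forward direction is vacuous bookkeeping).
[cite: CharlesSchnell2014Notes, Prop. 11.3.11 (proof)] -/
theorem variationalHodge_closing_iff (hCS : charlesSchnell_algebraicityLocus_iUnion_closed)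
    (h𝒳 : IsQuasiProjectiveOver 𝒳) (hS : IsQuasiProjectiveOver S) (hSsm : AlgebraicGeometry.Smooth S.hom)
    (hf : IsSmoothProjectiveFamily f n) (A : complexBetti 𝒳 (2 * p))
    (hthick : ∀ Z : ℕ → Set S.left, (∀ k, IsClosed (Z k)) → (∀ k, Z k ≠ Set.univ) →
      ¬ (Set.univ : Set (ComplexPoints S)) ⊆ ⋃ k, {t : ComplexPoints S | t.pt ∈ Z k}) :
    (∀ t : ComplexPoints S, complexBetti.map (fiberι f t) (2 * p) A ∈ algebraicClasses (fiberOver f t) p) ↔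
      ∀ Z : ℕ → Set S.left, (∀ k, IsClosed (Z k)) → (∀ k, Z k ≠ Set.univ) →
        ¬ {t : ComplexPoints S | complexBetti.map (fiberι f t) (2 * p) A ∈
            algebraicClasses (fiberOver f t) p} ⊆ ⋃ k, {t : ComplexPoints S | t.pt ∈ Z k} := by
  constructor
  · intro h Z hZc hZne hsub
    exact hthick Z hZc hZne fun t _ => hsub (h t)
  · intro h t
    exact variationalHodge_closing_of_thickSet f hCS h𝒳 hS hSsm hf A _ h (fun t ht => ht) t

/-! ### Thickness of the base and the local-to-global form (quasi-projective bases) -/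

/-- **Complex points of an irreducible quasi-projective `ℂ`-scheme are not covered by countably many
proper Zariski-closed subsets** (as soon as there is one complex point): `S(ℂ)` is a Baire space and
each `Zₖ(ℂ)` is closed with empty interior (the tree's PROVED `exists_eq_univ_of_isOpen_subset_iUnion`,
route `PadicSemiregularLift`, applied to `U = S(ℂ)`). This discharges the hypothesis `hthick` of
`variationalHodge_closing_iff`. [cite: VoisinHodgeII2003, §7.3.2, proof of Thm. 7.19]
[cite: SGA1, Exp. XII Prop. 2.2 and Cor. 2.3] -/
theorem univ_not_subset_iUnion_setOf_pt_mem (hS : IsQuasiProjectiveOver S) [IrreducibleSpace S.left]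
    [Nonempty (ComplexPoints S)] (Z : ℕ → Set S.left) (hZc : ∀ k, IsClosed (Z k))
    (hZne : ∀ k, Z k ≠ Set.univ) :
    ¬ (Set.univ : Set (ComplexPoints S)) ⊆ ⋃ k, {t : ComplexPoints S | t.pt ∈ Z k} := by
  intro hsub
  obtain ⟨j, hj⟩ := exists_eq_univ_of_isOpen_subset_iUnion hS hZc isOpen_univ Set.univ_nonempty hsub
  exact hZne j hj

/-- **The algebraicity locus is everything iff it is thick — unconditionally in the thickness of the
base**, for `S` irreducible and quasi-projective (`variationalHodge_closing_iff` with `hthick` supplied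
by `univ_not_subset_iUnion_setOf_pt_mem`). [cite: CharlesSchnell2014Notes, Prop. 11.3.11 (proof)]
[cite: VoisinHodgeII2003, §7.3.2, proof of Thm. 7.19] -/
theorem variationalHodge_closing_iff_of_irreducible (hCS : charlesSchnell_algebraicityLocus_iUnion_closed)
    (h𝒳 : IsQuasiProjectiveOver 𝒳) (hS : IsQuasiProjectiveOver S) (hSsm : AlgebraicGeometry.Smooth S.hom)
    [IrreducibleSpace S.left] [Nonempty (ComplexPoints S)] (hf : IsSmoothProjectiveFamily f n)
    (A : complexBetti 𝒳 (2 * p)) :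
    (∀ t : ComplexPoints S, complexBetti.map (fiberι f t) (2 * p) A ∈ algebraicClasses (fiberOver f t) p) ↔
      ∀ Z : ℕ → Set S.left, (∀ k, IsClosed (Z k)) → (∀ k, Z k ≠ Set.univ) →
        ¬ {t : ComplexPoints S | complexBetti.map (fiberι f t) (2 * p) A ∈
            algebraicClasses (fiberOver f t) p} ⊆ ⋃ k, {t : ComplexPoints S | t.pt ∈ Z k} :=
  variationalHodge_closing_iff f hCS h𝒳 hS hSsm hf A (univ_not_subset_iUnion_setOf_pt_mem hS)

/-- **Local-to-global form of the variational Hodge statement** (the shape `LocalToGlobal` of the crux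
ideation, round 1): for a smooth projective family with quasi-projective total space over a smooth
irreducible quasi-projective base and a global class `A`, if `A|_{𝒳_t}` is algebraic for all `t` in
SOME non-empty Euclidean-open subset of `S(ℂ)` — e.g. a neighbourhood of an anchor produced by a local
deformation-theoretic engine — then it is algebraic at every complex point. This is the tree's PROVED
`map_fiberι_mem_algebraicClasses_of_isOpen` (route `PadicSemiregularLift`), granted the Hilbert-scheme
fact `charlesSchnell_algebraicityLocus_iUnion_closed`; restated here so that the crux lines find it
next to the closing lemma. [cite: VoisinHodgeII2003, §7.3.2, proof of Thm. 7.19]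
[cite: CharlesSchnell2014Notes, Prop. 11.3.11 (proof)] -/
theorem variationalHodge_conclusion_of_isOpen (hCS : charlesSchnell_algebraicityLocus_iUnion_closed)
    (h𝒳 : IsQuasiProjectiveOver 𝒳) (hS : IsQuasiProjectiveOver S) (hSsm : AlgebraicGeometry.Smooth S.hom)
    (hirr : IrreducibleSpace S.left) (hf : IsSmoothProjectiveFamily f n) (A : complexBetti 𝒳 (2 * p))
    {U : Set (ComplexPoints S)} (hU : IsOpen U) (hUne : U.Nonempty)
    (hUalg : ∀ t ∈ U, complexBetti.map (fiberι f t) (2 * p) A ∈ algebraicClasses (fiberOver f t) p)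
    (t : ComplexPoints S) :
    complexBetti.map (fiberι f t) (2 * p) A ∈ algebraicClasses (fiberOver f t) p :=
  map_fiberι_mem_algebraicClasses_of_isOpen hCS f h𝒳 hS hSsm hirr hf A hU hUne hUalg t

end Summit.HodgeConjecture.HodgeConjecture.Theorems

end
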